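/-
Copyright (c) 2026. All rights reserved.
Released under Apache 2.0 license as described in the file LICENSE.
-/
import Literature.AlgebraicGeometry.ComplexMultiplication.HyperellipticJacobianSimpleFourfoldQuadraticSubfieldMultiplicities
import HarnessLib

/-!
# `Z = E'² × Y_{40}` is of WEIL TYPE for `k = ℚ(√−2)` with multiplicities `(3, 3)` at the level of CM types — Moonen–Zarhin's §5 Case 2 «`Z := E² × Y`» inside `J_{40}`

Family `hodge`, cell `pub-hodgecm2` (COR-CM), KEPT Literature lane `lit-deligne-3` (generation 55, file F50; sequel of F43 (the `(3,3)`-class on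
`E' × E' × Y_{40}`), F47 (`ℚ(√−2)` on `Ψ_{40}`: `(1,3)`), F49 (the `ℚ(i)`-analogue for `E_i × Y_{4p}`)).  THEOREMS ONLY: no definition, no named
fact, no `sorry`, no instance; D-0026 net debt `0`.  Nothing here asserts the algebraicity of any class; HC_CM is NOT proved.

THE POINT.  Moonen–Zarhin §5 Case 2 [corpus: paper:arxiv-math_9901113 p. 10]: «Rather than looking at `E × Y`, let us look at `Z := E² × Y`. There is
an embedding `k ↪ End⁰(Z)` such that `k` acts on `T_{Z,0}` with multiplicities `(3,3)`. This implies that the corresponding space of Weil classes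
`W_k ⊂ H⁶(Z, ℚ)` consists of Hodge classes».  Inside `J_{40}` (`X_8 ∼ E'²`, `X_{40} ∼ Y_{40}²`): `k = ℚ(√−2) = ℚ(ζ_8 − ζ_8^{−1})`, and
`w = ζ_{40}^5 − ζ_{40}^{−5} ∈ L_{40}` (F46 §4).  Embed `k ↪ End⁰(X_8) × L_{40} ⊇ ℚ(ζ_8) × L_{40}` by `√−2 ↦ (ζ_8⁷ − ζ_8^{−7}, w)` — the CONJUGATE
`−(ζ_8 − ζ_8^{−1})` on `X_8 = E'²`.  On the CM types: BOTH members of the lower-half type `Φ_8` (exponents `1, 3`) send `ζ_8⁷ − ζ_8^{−7}` to the same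
value `c = μ⁷ − μ^{−7}`, `μ = e^{2πi/8}` (§1: `μ²¹ − μ^{−21} = μ⁵ − μ^{−5} = μ⁷ − μ^{−7}` since `μ⁵μ⁷ = −1`), while `Ψ_{40}` sends `w ↦ c` for ONE member and
`↦ −c` for THREE (F47, `c = σ₇(w)` with `μ_{40}^5 = μ_8`).  Total **`(2 + 1, 0 + 3) = (3, 3)`: `Z = X_8 × Y_{40} = E'² × Y_{40}` is of Weil type for
`k`**, Weil codimension `3 = dim Z / 2` — exactly the degree of F43's exceptional `(3,3)`-class on `E' × E' × Y_{40}`.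

WHAT IS PROVED.
* §1 **`ncard_cmType_level_eight`** — `#{σ ∈ Φ_8 : σ(ζ_8⁷ − ζ_8^{−7}) = c} = 2`, `#{… = −c} = 0` for `c = μ⁷ − μ^{−7}`.
* §2 **`weilType_multiplicities_cmCurveSq_simpleFourfold`** — for the lower-half types `Φ_8`, `Φ_{40}` and an index-`2` sub-pair `(L; Ψ)` with
  `Ψ^K = Φ_{40}`, `w ∈ L`: `∃ c` (`c² = −2`): `#{σ ∈ Φ_8 : σ ↦ c} + #{ρ ∈ Ψ : ρ(w) = c} = 3 = #{σ ∈ Φ_8 : σ ↦ −c} + #{ρ ∈ Ψ : ρ(w) = −c}`.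

HONEST.  CM-TYPE LEVEL ONLY (as F49): the Hodge-structure `IsOfWeilType` on `H¹(Z)` is NOT instantiated; F43's class is NOT shown to lie in `W_k`;
Markman's theorem on sixfolds of (split) Weil type [Markman2025SurveySecant, Thm. 1.2] is NOT applied; no algebraicity claim.  No numerics.

## References
* [MoonenZarhin1999LowDim] B. Moonen, Yu. Zarhin, Math. Ann. 315 (1999): §5 Case 2, Thm. 0.2 (3), (1.9) [corpus: paper:arxiv-math_9901113 p. 10].
  [cite: MoonenZarhin1999LowDim, §5 Case 2 and Thm. 0.2 (3)]
* [vanGeemen1994HodgeAV] B. van Geemen, LNM 1594 (1994), §5. [cite: vanGeemen1994HodgeAV, §5]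
* [Markman2025SurveySecant] E. Markman (2025), Thm. 1.2 — context only. [cite: Markman2025SurveySecant, Thm. 1.2]
* [GalleseGoodsonLombardo2024] Gallese–Goodson–Lombardo, §3 Thm. 3.0 (5), §3.2 Lemma 11. [cite: GalleseGoodsonLombardo2024, §3 Thm. 3.0 (5) and §3.2 Lemma 11]
* [Washington1997] L. C. Washington, Thm. 2.5. [cite: Washington1997, Thm. 2.5]
-/

open CategoryTheory CategoryTheory.Limits NumberField Module

namespace Literature.AlgebraicGeometry.ComplexMultiplication

open Literature.AlgebraicGeometry.Motives
open Literature.NumberTheory.ComplexMultiplication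

namespace HyperellipticJacobian

open Literature.AlgebraicGeometry.Pohlmann1968 Literature.AlgebraicGeometry.Pohlmann1968.Cyclotomic
open Literature.AlgebraicGeometry.Pohlmann1968.CMAlgebra

/-! ## §1 The member `X_8 = E'²`: both embeddings of the lower-half type `Φ_8` send `ζ_8⁷ − ζ_8^{−7} = −(ζ_8 − ζ_8^{−1})` to `e^{2πi·35/40} − e^{−2πi·35/40}` -/

section LevelEight

/-- In a field, `a − a^{−1} = b − b^{−1}` if `ab = −1`. [folklore] -/
private theorem sub_inv_eq_sub_inv_of_mul_eq_neg_one {F : Type*} [Field F] {a b : F} (h : a * b = -1) :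
    a - a⁻¹ = b - b⁻¹ := by
  have ha' : a⁻¹ = -b := inv_eq_of_mul_eq_one_right (by rw [mul_neg, h, neg_neg])
  have hb' : b⁻¹ = -a := inv_eq_of_mul_eq_one_right (by rw [mul_neg, mul_comm, h, neg_neg])
  rw [ha', hb']
  ring

/-- `e^{2πi/40}` to the `5` is `e^{2πi/8}`. [folklore] -/
private theorem rootζ_forty_pow_five : rootζ 40 ^ 5 = rootζ 8 := by
  rw [rootζ, rootζ, ← Complex.exp_nat_mul]
  congr 1
  push_cast
  ring

/-- `(e^{2πi/8})⁴ = −1`. [folklore] -/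
private theorem rootζ_eight_pow_four : rootζ 8 ^ 4 = -1 := by
  have hμ : IsPrimitiveRoot (rootζ 8) 8 := by simpa [rootζ] using Complex.isPrimitiveRoot_exp 8 (by norm_num)
  exact (hμ.pow (by norm_num) (show 8 = 4 * 2 by rfl)).eq_neg_one_of_two_right

variable {N₀ : ℕ} [NeZero N₀] {K₀ : Type} [Field K₀] [NumberField K₀] [IsCyclotomicExtension {N₀} ℚ K₀]

/-- **Both members of the lower-half type `Φ_8` of `ℚ(ζ_8)` (exponents `1, 3`) send `ζ_8⁷ − ζ_8^{−7}` (the conjugate `−√−2` of `ζ_8 − ζ_8^{−1}`) to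
the same value `c₈ = μ⁷ − μ^{−7}`, `μ = e^{2πi/8}`** (`μ²¹ − μ^{−21} = μ⁵ − μ^{−5} = μ⁷ − μ^{−7}` as `μ⁵μ⁷ = μ¹² = −1`); so `#{σ ∈ Φ_8 : σ(ζ_8⁷ − ζ_8^{−7}) = c₈} = 2`
and `#{… = −c₈} = 0`. [cite: Washington1997, Thm. 2.5] [cite: MoonenZarhin1999LowDim, §5 Case 2] -/
theorem ncard_cmType_level_eight (hN : N₀ = 8) (Φ₀ : CMType K₀) (hΦ : ∀ σ : K₀ →+* ℂ, σ ∈ Φ₀.1 ↔ 2 * (expOf N₀ K₀ σ).val < N₀) :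
    {σ | σ ∈ Φ₀.1 ∧ σ (zetaOf N₀ K₀ ^ 7 - (zetaOf N₀ K₀ ^ 7)⁻¹) = rootζ 8 ^ 7 - (rootζ 8 ^ 7)⁻¹}.ncard = 2 ∧
      {σ | σ ∈ Φ₀.1 ∧ σ (zetaOf N₀ K₀ ^ 7 - (zetaOf N₀ K₀ ^ 7)⁻¹) = -(rootζ 8 ^ 7 - (rootζ 8 ^ 7)⁻¹)}.ncard = 0 := by
  classical
  subst hN
  have hμ : IsPrimitiveRoot (rootζ 8) 8 := by simpa [rootζ] using Complex.isPrimitiveRoot_exp 8 (by norm_num)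
  have hμ0 : rootζ 8 ≠ 0 := hμ.ne_zero (by norm_num)
  -- the members of `Φ₀` have exponent `1` or `3`
  have he : ∀ σ : K₀ →+* ℂ, σ ∈ Φ₀.1 ↔ ((expOf 8 K₀ σ).val = 1 ∨ (expOf 8 K₀ σ).val = 3) := fun σ => by
    rw [hΦ]
    have hcop := coprime_expOf 8 K₀ σ
    have hlt := ZMod.val_lt (expOf 8 K₀ σ)
    constructor
    · intro h
      have hv : (expOf 8 K₀ σ).val < 4 := by omega
      interval_cases hh : (expOf 8 K₀ σ).val
      · exact absurd hcop (by decide)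
      · exact Or.inl rfl
      · exact absurd hcop (by decide)
      · exact Or.inr rfl
    · rintro (h | h) <;> rw [h] <;> norm_num
  -- the common value
  have hval : ∀ σ : K₀ →+* ℂ, σ ∈ Φ₀.1 → σ (zetaOf 8 K₀ ^ 7 - (zetaOf 8 K₀ ^ 7)⁻¹) = rootζ 8 ^ 7 - (rootζ 8 ^ 7)⁻¹ := fun σ hσ => by
    rw [map_sub, map_inv₀, map_pow, expOf_spec 8 K₀ σ, ← pow_mul]
    rcases (he σ).1 hσ with h | h
    · rw [h]
    · rw [h, show rootζ 8 ^ (3 * 7) = rootζ 8 ^ 5 by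
        rw [show 3 * 7 = 8 * 2 + 5 by rfl, pow_add, pow_mul, hμ.pow_eq_one, one_pow, one_mul]]
      exact sub_inv_eq_sub_inv_of_mul_eq_neg_one (by
        rw [← pow_add, show 5 + 7 = 8 + 4 by rfl, pow_add, hμ.pow_eq_one, one_mul, rootζ_eight_pow_four])
  -- the value is nonzero: `(μ⁷ − μ^{−7})² = −2`
  have hc0 : rootζ 8 ^ 7 - (rootζ 8 ^ 7)⁻¹ ≠ 0 := by
    intro h
    have h7 : rootζ 8 ^ 7 = (rootζ 8 ^ 7)⁻¹ := sub_eq_zero.1 h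
    have h14 : rootζ 8 ^ 14 = 1 := by
      rw [show 14 = 7 + 7 by rfl, pow_add]
      nth_rewrite 2 [h7]
      exact mul_inv_cancel₀ (pow_ne_zero 7 hμ0)
    have := (hμ.pow_eq_one_iff_dvd 14).1 h14
    omega
  refine ⟨?_, ?_⟩
  · -- `= Φ₀`, which has the two members of exponents `1` and `3`
    obtain ⟨σ₁, hσ₁⟩ := exists_expOf_eq 8 K₀ (1 : ZMod 8) (by decide)
    obtain ⟨σ₃, hσ₃⟩ := exists_expOf_eq 8 K₀ (3 : ZMod 8) (by decide)
    have h1 : (expOf 8 K₀ σ₁).val = 1 := by rw [hσ₁]; rfl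
    have h3 : (expOf 8 K₀ σ₃).val = 3 := by rw [hσ₃]; rfl
    have hne : σ₁ ≠ σ₃ := by
      intro h; rw [h] at h1; omega
    have hset : {σ | σ ∈ Φ₀.1 ∧ σ (zetaOf 8 K₀ ^ 7 - (zetaOf 8 K₀ ^ 7)⁻¹) = rootζ 8 ^ 7 - (rootζ 8 ^ 7)⁻¹} =
        ↑({σ₁, σ₃} : Finset (K₀ →+* ℂ)) := by
      ext σ
      simp only [Set.mem_setOf_eq, Finset.coe_insert, Finset.coe_singleton, Set.mem_insert_iff, Set.mem_singleton_iff]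
      constructor
      · rintro ⟨hσ, -⟩
        rcases (he σ).1 hσ with h | h
        · exact Or.inl (expOf_injective 8 K₀ (ZMod.val_injective 8 (h.trans h1.symm)))
        · exact Or.inr (expOf_injective 8 K₀ (ZMod.val_injective 8 (h.trans h3.symm)))
      · rintro (rfl | rfl)
        · exact ⟨(he _).2 (Or.inl h1), hval _ ((he _).2 (Or.inl h1))⟩
        · exact ⟨(he _).2 (Or.inr h3), hval _ ((he _).2 (Or.inr h3))⟩
    rw [hset, Set.ncard_coe_finset, Finset.card_pair hne]
  · rw [Set.ncard_eq_zero]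
    ext σ
    simp only [Set.mem_setOf_eq, Set.mem_empty_iff_false, iff_false, not_and]
    intro hσ h
    rw [hval σ hσ] at h
    apply hc0
    linear_combination h / 2

end LevelEight

/-! ## §2 `Z = E'² × Y_{40}`: `k = ℚ(√−2)`, embedded as `√−2 ↦ (ζ_8⁷ − ζ_8^{−7}, ζ_{40}^5 − ζ_{40}^{−5})`, acts on the CM type `Φ_8 ⊔ Ψ_{40}` with multiplicities `(3, 3)` -/

section WeilTypeZ

variable {N₀ : ℕ} [NeZero N₀] {K₀ : Type} [Field K₀] [NumberField K₀] [IsCyclotomicExtension {N₀} ℚ K₀]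
  {N : ℕ} [NeZero N] {K : Type} [Field K] [NumberField K] [IsCyclotomicExtension {N} ℚ K]

/-- Counting through a 2-to-1 restriction. [cite: Shimura1998, §6.2 Thm. 3 (proof)] -/
private theorem ncard_eq_two_mul_ncard₃ {L : IntermediateField ℚ K} {Ψ : CMType L} {Φ : CMType K}
    (hind : inducedCMType (algebraMap L K) Ψ = Φ) (hfin : Module.finrank L K = 2) (x : L) (c : ℂ) :
    {σ : K →+* ℂ | σ ∈ Φ.1 ∧ σ (x : K) = c}.ncard = 2 * {ρ : L →+* ℂ | ρ ∈ Ψ.1 ∧ ρ x = c}.ncard := by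
  classical
  have h := card_filter_comp_mem (K := K) (L := L) (Finset.univ.filter fun ρ : L →+* ℂ => ρ ∈ Ψ.1 ∧ ρ x = c)
  rw [hfin] at h
  have e1 : {σ : K →+* ℂ | σ ∈ Φ.1 ∧ σ (x : K) = c} = ↑(Finset.univ.filter fun σ : K →+* ℂ =>
      σ.comp (algebraMap L K) ∈ (Finset.univ.filter fun ρ : L →+* ℂ => ρ ∈ Ψ.1 ∧ ρ x = c)) := by
    ext σ
    simp only [Set.mem_setOf_eq, Finset.coe_filter, Finset.mem_filter, Finset.mem_univ, true_and, RingHom.coe_comp,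
      Function.comp_apply, ← hind, mem_inducedCMType_iff]
    rfl
  have e2 : {ρ : L →+* ℂ | ρ ∈ Ψ.1 ∧ ρ x = c} = ↑(Finset.univ.filter fun ρ : L →+* ℂ => ρ ∈ Ψ.1 ∧ ρ x = c) := by
    ext ρ
    simp only [Set.mem_setOf_eq, Finset.coe_filter, Finset.mem_univ, true_and]
  rw [e1, e2, Set.ncard_coe_finset, Set.ncard_coe_finset, h]

/-- **`Z = E'² × Y_{40}` IS OF WEIL TYPE FOR `k = ℚ(√−2)` WITH MULTIPLICITIES `(3, 3)` AT THE LEVEL OF CM TYPES** — Moonen–Zarhin §5 Case 2: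
«Rather than looking at `E × Y`, let us look at `Z := E² × Y`. There is an embedding `k ↪ End⁰(Z)` such that `k` acts on `T_{Z,0}` with multiplicities
`(3,3)`. This implies that the corresponding space of Weil classes `W_k ⊂ H⁶(Z, ℚ)` consists of Hodge classes».  Explicitly inside `J_{40}`: with the
lower-half type `Φ_8` of `X_8 ∼ E'²` (2 embeddings) and the CM type `(L; Ψ)` of `Y_{40}` (`Ψ^K = Φ_{40}`, index `2`, `w = ζ_{40}^5 − ζ_{40}^{−5} ∈ L`,
`w² = −2`), embed `k = ℚ(√−2)` by `√−2 ↦ (ζ_8⁷ − ζ_8^{−7}, w)` (the CONJUGATE `−(ζ_8 − ζ_8^{−1})` on `E'²`).  Then for `c = e^{2πi·7/8} − e^{−2πi·7/8}`: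
`#{σ ∈ Φ_8 : σ ↦ c} + #{ρ ∈ Ψ : ρ(w) = c} = 2 + 1 = 3` and `#{σ ∈ Φ_8 : σ ↦ −c} + #{ρ ∈ Ψ : ρ(w) = −c} = 0 + 3 = 3` (F47's `(1, 3)` on `Ψ_{40}`).  The Weil
codimension is `3 = dim Z / 2` — exactly where F43 located the `(3,3)`-class on `E' × E' × Y_{40}`.
[cite: MoonenZarhin1999LowDim, §5 Case 2 and Thm. 0.2 (3)] [cite: vanGeemen1994HodgeAV, §5] [cite: GalleseGoodsonLombardo2024, §3 Thm. 3.0 (5)]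
[cite: Washington1997, Thm. 2.5] -/
theorem weilType_multiplicities_cmCurveSq_simpleFourfold (hN₀ : N₀ = 8) (hN : N = 40)
    (Φ₀ : CMType K₀) (hΦ₀ : ∀ σ : K₀ →+* ℂ, σ ∈ Φ₀.1 ↔ 2 * (expOf N₀ K₀ σ).val < N₀)
    (Φ : CMType K) (hΦ : ∀ σ : K →+* ℂ, σ ∈ Φ.1 ↔ 2 * (expOf N K σ).val < N)
    {L : IntermediateField ℚ K} {Ψ : CMType L} (hind : inducedCMType (algebraMap L K) Ψ = Φ) (hfin : Module.finrank L K = 2)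
    (hw : zetaOf N K ^ 5 - (zetaOf N K ^ 5)⁻¹ ∈ L) :
    ∃ c : ℂ, c ^ 2 = -2 ∧
      {σ | σ ∈ Φ₀.1 ∧ σ (zetaOf N₀ K₀ ^ 7 - (zetaOf N₀ K₀ ^ 7)⁻¹) = c}.ncard + {ρ | ρ ∈ Ψ.1 ∧ ρ ⟨_, hw⟩ = c}.ncard = 3 ∧
      {σ | σ ∈ Φ₀.1 ∧ σ (zetaOf N₀ K₀ ^ 7 - (zetaOf N₀ K₀ ^ 7)⁻¹) = -c}.ncard + {ρ | ρ ∈ Ψ.1 ∧ ρ ⟨_, hw⟩ = -c}.ncard = 3 := by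
  obtain ⟨h2, h0⟩ := ncard_cmType_level_eight hN₀ Φ₀ hΦ₀
  obtain ⟨σ₀, -, h7, hP, hM⟩ := exists_multiplicities_two_six_of_level_forty hN Φ hΦ
  have hsq := zetaOf_pow_five_sub_inv_sq (K := K) hN
  -- the value `c = σ₀(w) = μ₈⁷ − μ₈^{−7}`
  have hc : σ₀ (zetaOf N K ^ 5 - (zetaOf N K ^ 5)⁻¹) = rootζ 8 ^ 7 - (rootζ 8 ^ 7)⁻¹ := by
    subst hN
    rw [map_sub, map_inv₀, map_pow, expOf_spec 40 K σ₀, h7, ← pow_mul, show 7 * 5 = 5 * 7 by rfl, pow_mul, rootζ_forty_pow_five]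
  have hplus := ncard_eq_two_mul_ncard₃ hind hfin ⟨_, hw⟩ (rootζ 8 ^ 7 - (rootζ 8 ^ 7)⁻¹)
  have hminus := ncard_eq_two_mul_ncard₃ hind hfin ⟨_, hw⟩ (-(rootζ 8 ^ 7 - (rootζ 8 ^ 7)⁻¹))
  rw [hc] at hP hM
  have eP : {σ : K →+* ℂ | σ ∈ Φ.1 ∧ σ ((⟨_, hw⟩ : L) : K) = rootζ 8 ^ 7 - (rootζ 8 ^ 7)⁻¹} =
      {σ | σ ∈ Φ.1 ∧ σ (zetaOf N K ^ 5 - (zetaOf N K ^ 5)⁻¹) = rootζ 8 ^ 7 - (rootζ 8 ^ 7)⁻¹} := rfl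
  have eM : {σ : K →+* ℂ | σ ∈ Φ.1 ∧ σ ((⟨_, hw⟩ : L) : K) = -(rootζ 8 ^ 7 - (rootζ 8 ^ 7)⁻¹)} =
      {σ | σ ∈ Φ.1 ∧ σ (zetaOf N K ^ 5 - (zetaOf N K ^ 5)⁻¹) = -(rootζ 8 ^ 7 - (rootζ 8 ^ 7)⁻¹)} := rfl
  rw [eP, hP] at hplus
  rw [eM, hM] at hminus
  refine ⟨rootζ 8 ^ 7 - (rootζ 8 ^ 7)⁻¹, ?_, ?_, ?_⟩
  · rw [← hc, ← map_pow, hsq, map_neg, map_ofNat]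
  · rw [h2]; omega
  · rw [h0]; omega

end WeilTypeZ

end HyperellipticJacobian

end Literature.AlgebraicGeometry.ComplexMultiplication
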